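import Summits.CriticalPhenomena.PercolationContinuityZ3.Theorems.PercNearOneGluingAdditiveGluingPairGluing
import HarnessLib

/-! # Crux `PercNearOneGluing.AdditiveGluing` (stmt-CriticalPhenomena-4576) — the "easy kernel": the pair event with a spy, bounded by the spy
# (seat (b) V⁺-form, depth prover `png-dp-vplus`, gen 8)

Support file (`--supports stmt-CriticalPhenomena-4576`); no definitions, no named facts, no sorries.

For bond percolation `μ = prodBernoulli w`, a target `b`, two vertices `ν, c` and a "spy" vertex `x`, consider the (non-monotone) event
`E_x = {ν ↔ b or c ↔ b, and x is not joined to the member of {ν, c} that is cut from b}`.  The residual KERNEL of the finger-stripping programme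
for conjecture G (memo MEMO-gen8 §6, §10.6, §11 of run/shared/lean/prim/prim-png-dp-vplus/) is the inequality `μ(E_x) ≥ min_{y ∈ ports(ν) ∪ {c}} μ(y ↔ b)`
for a hub vertex `ν`.  This file lands the part of it that holds for ARBITRARY vertices `ν, c, x` (no hub structure, no minimality):

  `min(μ(x↔b), μ(c↔b)) + μ(ν↔b, c↮b, x↔c) + μ(c↔b, ν↮b, x↔ν) ≤ μ({ν↔b} ∪ {c↔b})`        (`easyKernel_real`)

i.e. `μ(E_x) ≥ min(μ(x↔b), μ(c↔b))`: the KERNEL holds for every spy `x` that is not weaker than the weakest port, and what remains open is exactly the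
case of a weak spy (in the application `x = d`, the weakest relay).  The two cases: if `μ(c↔b) ≤ μ(x↔b)` one application of the SWAP lemma
(`swap_real_le`, "BHK three times") with `u := c`, `v := x` and rider `ν` moves `{c↔b, ν↮b, x↔ν}` into `{ν↔b, c↮b, x↮c}` (`easyKernel_of_le`); if
`μ(x↔b) ≤ μ(c↔b)` one application of Kozma–Nitzan's Lemma 3(ii) from `x` to `c` with the decreasing event `{ν ∉ C(x)}` and a four-way partition of
`{ν↔b} ∪ {c↔b}` do it (`easyKernel_of_ge`).
[cite: KozmaNitzan2024, Lemma 3(ii) (pp. 6–7); VandenbergHaggstromKahn2005, Thms 1.3, 1.5]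
-/

namespace Summit.CriticalPhenomena.PercolationContinuityZ3.Theorems

open MeasureTheory Set
open Literature.Probability.LatticeModels (prodBernoulli)
open Literature.Probability.Percolation

noncomputable section
open Classical

section EasyKernel

variable {V : Type*} [Fintype V]

/-- Two disjoint subsets of a set have total mass at most the mass of the set. [folklore] -/
theorem measureReal_add_le_of_subset_of_disjoint (w : Sym2 V → unitInterval) {A B C : Set (BondConfig V)}
    (hA : A ⊆ C) (hB : B ⊆ C) (hAB : Disjoint A B) :
    (prodBernoulli w).real A + (prodBernoulli w).real B ≤ (prodBernoulli w).real C := by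
  rw [← measureReal_union hAB MeasurableSet.of_discrete]
  exact measureReal_mono (Set.union_subset hA hB) (measure_ne_top _ _)

/-- **Easy kernel, case `μ(c↔b) ≤ μ(x↔b)`.**  `μ(c↔b) + μ(ν↔b, c↮b, x↔c) + μ(c↔b, ν↮b, x↔ν) ≤ μ({ν↔b} ∪ {c↔b})`: the second loss term is moved by the
SWAP lemma (`u := c`, `v := x`, rider `ν`) into `{ν↔b, c↮b, x↮c}`, disjoint from the first inside `{ν↔b} ∖ {c↔b}`.
[cite: VandenbergHaggstromKahn2005, Thms 1.3, 1.5; KozmaNitzan2024, Lemma 3(ii) (pp. 6–7)] -/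
theorem easyKernel_of_le (w : Sym2 V → unitInterval) (ν c x b : V)
    (hcx : (prodBernoulli w).real (openConn c b) ≤ (prodBernoulli w).real (openConn x b)) :
    (prodBernoulli w).real (openConn c b) +
        (prodBernoulli w).real (openConn ν b ∩ {ω | ¬ (openGraph ω).Reachable c b} ∩ openConn x c) +
        (prodBernoulli w).real (openConn c b ∩ {ω | ¬ (openGraph ω).Reachable ν b} ∩ openConn x ν) ≤
      (prodBernoulli w).real (openConn ν b ∪ openConn c b) := by
  set μ := prodBernoulli w with hμ
  set Ψ₁ : Set (BondConfig V) := openConn ν b ∩ {ω | ¬ (openGraph ω).Reachable c b} ∩ openConn x c with hΨ₁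
  set Ψ₂ : Set (BondConfig V) := openConn c b ∩ {ω | ¬ (openGraph ω).Reachable ν b} ∩ openConn x ν with hΨ₂
  set R : Set (BondConfig V) := openConn ν b \ openConn c b with hR
  have hsplit : μ.real (openConn ν b ∪ openConn c b) = μ.real (openConn c b) + μ.real R := by
    rw [Set.union_comm, ← Set.union_sdiff_self (s := openConn c b), measureReal_union Set.disjoint_sdiff_right MeasurableSet.of_discrete]
  have hΨ₁R : Ψ₁ ⊆ R ∩ openConn x c := by
    rintro ω ⟨⟨hνb, hncb⟩, hxc⟩
    exact ⟨⟨hνb, hncb⟩, hxc⟩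
  suffices hmain : μ.real Ψ₁ + μ.real Ψ₂ ≤ μ.real R by linarith
  by_cases hceq : c = x
  · -- `c = x`: the second loss event is empty
    subst hceq
    have hΨ₂e : Ψ₂ ⊆ (∅ : Set (BondConfig V)) := by
      rintro ω ⟨⟨hcb, hnνb⟩, hcν⟩
      exact (hnνb ((show (openGraph ω).Reachable c ν from hcν).symm.trans hcb)).elim
    have h0 : μ.real Ψ₂ ≤ 0 := by
      have := measureReal_mono (μ := μ) hΨ₂e (measure_ne_top _ _)
      rwa [measureReal_empty] at this
    have h1 : μ.real Ψ₁ ≤ μ.real R := measureReal_mono (hΨ₁R.trans Set.inter_subset_left) (measure_ne_top _ _)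
    linarith
  · -- `c ≠ x`: SWAP
    have hswap := swap_real_le w c x ν b hceq hcx
    have h1 : Ψ₂ ⊆ {ω : BondConfig V | ¬ (openGraph ω).Reachable c x} ∩ (openConn c b ∩ openConn x ν) := by
      rintro ω ⟨⟨hcb, hnνb⟩, hxν⟩
      refine ⟨fun hcx' => hnνb ?_, hcb, hxν⟩
      exact (show (openGraph ω).Reachable x ν from hxν).symm.trans (hcx'.symm.trans hcb)
    have h2 : {ω : BondConfig V | ¬ (openGraph ω).Reachable c x} ∩ (openConn x b ∩ openConn x ν) ⊆
        R ∩ {ω | ¬ (openGraph ω).Reachable x c} := by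
      rintro ω ⟨hncx, hxb, hxν⟩
      have hncx' : ¬ (openGraph ω).Reachable c x := hncx
      refine ⟨⟨?_, fun hcb => hncx' ?_⟩, fun hxc => hncx' hxc.symm⟩
      · exact (show (openGraph ω).Reachable x ν from hxν).symm.trans hxb
      · exact (show (openGraph ω).Reachable c b from hcb).trans (show (openGraph ω).Reachable x b from hxb).symm
    have hdisj : Disjoint (R ∩ openConn x c) (R ∩ {ω | ¬ (openGraph ω).Reachable x c}) := by
      rw [Set.disjoint_left]
      rintro ω ⟨-, hxc⟩ ⟨-, hnxc⟩
      exact hnxc hxc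
    calc μ.real Ψ₁ + μ.real Ψ₂
        ≤ μ.real (R ∩ openConn x c) + μ.real (R ∩ {ω | ¬ (openGraph ω).Reachable x c}) :=
          add_le_add (measureReal_mono hΨ₁R (measure_ne_top _ _))
            ((measureReal_mono h1 (measure_ne_top _ _)).trans (hswap.trans (measureReal_mono h2 (measure_ne_top _ _))))
      _ ≤ μ.real R :=
          measureReal_add_le_of_subset_of_disjoint w Set.inter_subset_left Set.inter_subset_left hdisj

/-- **Easy kernel, case `μ(x↔b) ≤ μ(c↔b)`.**  `μ(x↔b) + μ(ν↔b, c↮b, x↔c) + μ(c↔b, ν↮b, x↔ν) ≤ μ({ν↔b} ∪ {c↔b})`: Lemma 3(ii) moves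
`{x↔b, x↮ν}` into `{c↔b, x↮ν}`, and `{ν↔b} ∪ {c↔b}` is the disjoint union of `{c↔b, x↮ν}`, `{c↔b, x↔ν, ν↮b}` (the second loss event),
`{c↔b, x↔ν, ν↔b} ⊇ {ν↔b, x↔b, c↔b}` and `{ν↔b, c↮b} ⊇ {ν↔b, x↔b, c↮b} ⊔ {ν↔b, c↮b, x↔c}`.
[cite: KozmaNitzan2024, Lemma 3(ii) (pp. 6–7)] -/
theorem easyKernel_of_ge (w : Sym2 V → unitInterval) (ν c x b : V)
    (hxc : (prodBernoulli w).real (openConn x b) ≤ (prodBernoulli w).real (openConn c b)) :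
    (prodBernoulli w).real (openConn x b) +
        (prodBernoulli w).real (openConn ν b ∩ {ω | ¬ (openGraph ω).Reachable c b} ∩ openConn x c) +
        (prodBernoulli w).real (openConn c b ∩ {ω | ¬ (openGraph ω).Reachable ν b} ∩ openConn x ν) ≤
      (prodBernoulli w).real (openConn ν b ∪ openConn c b) := by
  set μ := prodBernoulli w with hμ
  set Ψ₁ : Set (BondConfig V) := openConn ν b ∩ {ω | ¬ (openGraph ω).Reachable c b} ∩ openConn x c with hΨ₁
  set Ψ₂ : Set (BondConfig V) := openConn c b ∩ {ω | ¬ (openGraph ω).Reachable ν b} ∩ openConn x ν with hΨ₂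
  set D : Set (BondConfig V) := {ω | ∀ u ∈ ({ν} : Set V), ¬ (openGraph ω).Reachable x u} with hD
  have hDiff : ∀ ω : BondConfig V, ω ∈ D ↔ ¬ (openGraph ω).Reachable x ν := by
    intro ω; simp [hD]
  -- Lemma 3(ii): `μ(x↔b, x↮ν) ≤ μ(c↔b, x↮ν)`
  have hL3 : μ.real (openConn x b ∩ D) ≤ μ.real (openConn c b ∩ D) :=
    KozmaNitzan2024_lemma3_ii_notConn w x c b ({ν} : Set V) hxc
  -- the four target pieces
  set T1 : Set (BondConfig V) := openConn c b ∩ D with hT1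
  set T2 : Set (BondConfig V) := openConn c b ∩ Dᶜ ∩ {ω | ¬ (openGraph ω).Reachable ν b} with hT2
  set T3 : Set (BondConfig V) := openConn c b ∩ Dᶜ ∩ openConn ν b with hT3
  set T4 : Set (BondConfig V) := openConn ν b ∩ {ω | ¬ (openGraph ω).Reachable c b} with hT4
  -- `μ(x↔b) = μ(x↔b ∩ D) + μ(x↔b \ D)`
  have hxsplit : μ.real (openConn x b) = μ.real (openConn x b ∩ D) + μ.real (openConn x b \ D) :=
    (measureReal_inter_add_sdiff (μ := μ) (s := openConn x b) (t := D) MeasurableSet.of_discrete (measure_ne_top _ _)).symm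
  -- (2) the second loss event is `T2`
  have h2 : Ψ₂ ⊆ T2 := by
    rintro ω ⟨⟨hcb, hnνb⟩, hxν⟩
    exact ⟨⟨hcb, fun hD' => ((hDiff ω).1 hD') hxν⟩, hnνb⟩
  -- (3) `μ(x↔b \ D) + μ(Ψ₁) ≤ μ(T3) + μ(T4)`
  have h3a : openConn x b \ D ⊆ T3 ∪ (T4 ∩ openConn x b) := by
    rintro ω ⟨hxb, hnD⟩
    have hxν : (openGraph ω).Reachable x ν := by
      by_contra h; exact hnD ((hDiff ω).2 h)
    have hνb : (openGraph ω).Reachable ν b := hxν.symm.trans hxb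
    by_cases hcb : (openGraph ω).Reachable c b
    · exact Or.inl ⟨⟨hcb, hnD⟩, hνb⟩
    · exact Or.inr ⟨⟨hνb, hcb⟩, hxb⟩
  have h3b : Ψ₁ ⊆ T4 \ openConn x b := by
    rintro ω ⟨⟨hνb, hncb⟩, hxc⟩
    refine ⟨⟨hνb, hncb⟩, fun hxb => hncb ?_⟩
    exact (show (openGraph ω).Reachable x c from hxc).symm.trans hxb
  have h3disj : Disjoint T3 (T4 ∩ openConn x b) := by
    rw [Set.disjoint_left]
    rintro ω ⟨⟨hcb, -⟩, -⟩ ⟨⟨-, hncb⟩, -⟩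
    exact hncb hcb
  have h3 : μ.real (openConn x b \ D) + μ.real Ψ₁ ≤ μ.real T3 + μ.real T4 := by
    have hT4split : μ.real (T4 ∩ openConn x b) + μ.real (T4 \ openConn x b) = μ.real T4 :=
      measureReal_inter_add_sdiff (μ := μ) (s := T4) (t := openConn x b) MeasurableSet.of_discrete (measure_ne_top _ _)
    calc μ.real (openConn x b \ D) + μ.real Ψ₁
        ≤ μ.real (T3 ∪ (T4 ∩ openConn x b)) + μ.real (T4 \ openConn x b) :=
          add_le_add (measureReal_mono h3a (measure_ne_top _ _)) (measureReal_mono h3b (measure_ne_top _ _))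
      _ = μ.real T3 + μ.real (T4 ∩ openConn x b) + μ.real (T4 \ openConn x b) := by
          rw [measureReal_union h3disj MeasurableSet.of_discrete]
      _ = μ.real T3 + μ.real T4 := by rw [add_assoc, hT4split]
  -- (4) the four pieces are disjoint parts of `{ν↔b} ∪ {c↔b}`
  have h12 : Disjoint T1 T2 := by
    rw [Set.disjoint_left]; rintro ω ⟨-, hD'⟩ ⟨⟨-, hnD⟩, -⟩; exact hnD hD'
  have h123 : Disjoint (T1 ∪ T2) T3 := by
    rw [Set.disjoint_left]
    rintro ω (⟨-, hD'⟩ | ⟨⟨-, -⟩, hnνb⟩) ⟨⟨-, hnD⟩, hνb⟩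
    · exact hnD hD'
    · exact hnνb hνb
  have h1234 : Disjoint (T1 ∪ T2 ∪ T3) T4 := by
    rw [Set.disjoint_left]
    rintro ω (( ⟨hcb, -⟩ | ⟨⟨hcb, -⟩, -⟩) | ⟨⟨hcb, -⟩, -⟩) ⟨-, hncb⟩
    · exact hncb hcb
    · exact hncb hcb
    · exact hncb hcb
  have hsub : T1 ∪ T2 ∪ T3 ∪ T4 ⊆ openConn ν b ∪ openConn c b := by
    rintro ω (((⟨hcb, -⟩ | ⟨⟨hcb, -⟩, -⟩) | ⟨⟨hcb, -⟩, -⟩) | ⟨hνb, -⟩)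
    · exact Or.inr hcb
    · exact Or.inr hcb
    · exact Or.inr hcb
    · exact Or.inl hνb
  have h4 : μ.real T1 + μ.real T2 + μ.real T3 + μ.real T4 ≤ μ.real (openConn ν b ∪ openConn c b) := by
    rw [← measureReal_union h12 MeasurableSet.of_discrete, ← measureReal_union h123 MeasurableSet.of_discrete,
      ← measureReal_union h1234 MeasurableSet.of_discrete]
    exact measureReal_mono hsub (measure_ne_top _ _)
  -- assemble
  have h2' : μ.real Ψ₂ ≤ μ.real T2 := measureReal_mono h2 (measure_ne_top _ _)
  rw [hxsplit]
  linarith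

/-- **Easy kernel.**  For bond percolation on a finite weighted graph, a target `b` and ANY three vertices `ν, c, x`:
`min(μ(x↔b), μ(c↔b)) + μ(ν↔b, c↮b, x↔c) + μ(c↔b, ν↮b, x↔ν) ≤ μ({ν↔b} ∪ {c↔b})`, i.e. the probability that `ν` or `c` is joined to `b` while the
spy `x` is not glued to the member cut from `b` is at least `min(μ(x↔b), μ(c↔b))`.  (So the finger-stripping KERNEL, which asks for the minimum over
the ports of a hub `ν` and `c` instead, is open only for spies weaker than every port.) [cite: KozmaNitzan2024, Lemma 3(ii) (pp. 6–7);
VandenbergHaggstromKahn2005, Thms 1.3, 1.5] -/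
theorem easyKernel_real (w : Sym2 V → unitInterval) (ν c x b : V) :
    min ((prodBernoulli w).real (openConn x b)) ((prodBernoulli w).real (openConn c b)) +
        (prodBernoulli w).real (openConn ν b ∩ {ω | ¬ (openGraph ω).Reachable c b} ∩ openConn x c) +
        (prodBernoulli w).real (openConn c b ∩ {ω | ¬ (openGraph ω).Reachable ν b} ∩ openConn x ν) ≤
      (prodBernoulli w).real (openConn ν b ∪ openConn c b) := by
  rcases le_total ((prodBernoulli w).real (openConn x b)) ((prodBernoulli w).real (openConn c b)) with h | h
  · rw [min_eq_left h]; exact easyKernel_of_ge w ν c x b h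
  · rw [min_eq_right h]; exact easyKernel_of_le w ν c x b h

end EasyKernel

end

end Summit.CriticalPhenomena.PercolationContinuityZ3.Theorems
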